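import Summits.BirchSwinnertonDyer.BirchSwinnertonDyer.Theorems.ByReductionTypeAtTwoTowerLayerGreenberg
import Summits.BirchSwinnertonDyer.BirchSwinnertonDyer.Theorems.ByReductionTypeAtTwoTowerLayerFrobenius
import Summits.BirchSwinnertonDyer.BirchSwinnertonDyer.Theorems.ByReductionTypeAtTwoOrdEisensteinHalfShaIsogeny
import HarnessLib

/-!
# The TOWER gap certificate with the SHARP decomposition count at the odd bad primes, and the
# doors in `Ш`-currency (no rank / `λ_an` / `μ_an` certificate) (route ByReductionTypeAtTwo, crux
# `OrdKatoHalfAtTwo`, item stmt-BirchSwinnertonDyer-19271; seat bsd-2adic-tower-1 GEN 2, D-0074 (T1),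
# part 6)

HONEST FRAMING (cell `bsd-2adic`, run/shared/lean/pub/bsd-2adic/, HUMAN RULINGS D-0036/D-0074): THEOREMS
ONLY; nothing asserted; no definition; no new named fact; closes nothing by itself. BSD is NOT proved by
any of this: a discharge closes a rung leaf of the `2`-adic class list, modulo the PUBLISHED inputs named
below (hypotheses BY NAME) and per-curve CERTIFICATES (computations, evidence-carried).

Two improvements of GEN 0's doors (`…TowerLayerGap.lean` part 3b, `…TowerLayerGreenberg.lean` part 4):

1. **Sharp exponent.** In the arithmetic certificate `2^d · ∏_{v ∈ S} C_v^{N_v} < 2^{2^{j'} − 2^j + a}`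
   the number `N_v` of primes of `ℚ_{j'}` above an odd `v` was the crude `2^{j'}`; part 5
   (`TowerLayer.exists_cover_card_le_odd_two`) proves the sharp **`N_v = 2^{min(j', v₂(ℓ_v² − 1) − 3)}`**,
   `ℓ_v = Rat.HeightOneSpectrum.natGenerator v` (`ℓ ≡ ±3 (mod 8)` ⇒ `N_v = 1` at every layer). Doors
   `towerGapAtTwo_of_localKernelBounds_sharp` (local kernel constants `C_v` as hypotheses in the tree's
   `𝒦_{v,n}`-currency — the socket for ANY print/kernel evaluation of the local kernels),
   `towerGapAtTwo_of_layerSelmer_of_greenberg_sharp` (GEN 0's PRINT binders `h33g`/`h33`/`h34` + `β_v`),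
   and `bsdp_two_/mazurMainConjecture_two_/katoHalfAt_two_of_layerSelmer_of_greenberg_sharp`.
2. **`Ш`-currency doors** (bsd-2adic-ord-3's suggestion, INBOX 06:39Z (iii)): composing the gap bridge
   with `EisensteinShaCurrency.bsdp_two_of_towerGap_of_missingLowerBoundAt` (p429012) gives
   `bsdp_two_of_layerSelmer_of_greenberg_sharp_of_missingLowerBoundAt` /
   `mazurMainConjecture_two_…`: `BSD(W,2)` resp. the `2`-adic IMC at a rank-`0` good-ordinary `W` with
   odd torsion from PRINT {modularity, GZK, Kato 17.4 (1)(2)@2, Greenberg Thm. 4.1@2, Lemmas 3.3/3.4@2}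
   + CERTIFICATES {`hper₀`, the GAP data `hlow`/`hup`/`β`/arithmetic, the descent inequality
   `MissingLowerBoundAt W 2` (`ord₂ #Ш_an ≤ ord₂ #Ш`, e.g. from `Ш[4] ≅ (ℤ/4)²` when `ord₂ #Ш_an = 4`)}
   — NO rank certificate `hrank`, NO `λ_an = n`, NO `μ_an = 0`, NO Prop. 4.14: the fragile certificate
   (c4) of GEN 0's CERT-SPEC §5 is not needed on this road.

References: R. Greenberg, LNM 1716 (1999), §3 Lemmas 3.3–3.5 (PDF pp. 86–90), Thm. 4.1; K. Kato,
Astérisque 295 (2004), Thm. 17.4; L. Washington, *Introduction to Cyclotomic Fields*, §13.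
-/

set_option autoImplicit false

noncomputable section

open scoped Classical MatrixGroups ModularForm

open NumberField IsDedekindDomain CongruenceSubgroup WeierstrassCurve Literature.NumberTheory.EllipticCurves
  Literature.NumberTheory.EllipticCurves.ModularForms Literature.NumberTheory.EllipticCurves.Rank1Residual
  Literature.NumberTheory.EllipticCurves.Rank1Residual.Typed
  Literature.NumberTheory.EllipticCurves.Greenberg1999
  Summit.BirchSwinnertonDyer.Rank1Residual.X1.MuLambda
  Summit.BirchSwinnertonDyer.Rank1Residual.X1.MuPart
  Summit.BirchSwinnertonDyer.Rank1Residual.X1.ParitySqueeze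
  Summit.BirchSwinnertonDyer.BirchSwinnertonDyer.Theorems.Rank1ResidualX1Defs
  Summit.BirchSwinnertonDyer.Rank1Residual.X5 Summit.BirchSwinnertonDyer.Rank1Residual.X5.O1
  Summit.BirchSwinnertonDyer.Rank1Residual.X5.TowerGap
  Summit.BirchSwinnertonDyer.Rank1Residual

namespace Summit.BirchSwinnertonDyer.BirchSwinnertonDyer.Theorems.KatoHalfPinch

section Curve

variable (W : WeierstrassCurve ℚ) [W.IsElliptic] [W.IsGloballyMinimal]

omit [W.IsGloballyMinimal] in
/-- **The GAP certificate from two layers, local kernel constants as hypotheses, SHARP covers.**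
`W/ℚ` with odd torsion order; layers `j ≤ j'`; certificates `2^a ≤ #Sel_{2^∞}(E/ℚ_j)[2]` and
`#Sel_{2^∞}(E/ℚ_{j'})[2] ≤ 2^d`; a finite set `S` of finite places with, at level `j'` for every
cyclotomic `κ`, `𝒦_{v,j'}[2^∞] = 0` off `S` (`h0`) and `#𝒦_{v,j'}[2] ≤ C_v` on `S` (`hC`); and the
arithmetic `2^d · ∏_{v ∈ S} C_v^{N_v} < 2^{2^{j'} − 2^j + a}` with the SHARP `N_v` (`1` at `2`,
`2^{min(j', v₂(ℓ_v² − 1) − 3)}` at odd `v`; part 5). Then `O1.TowerGapAtTwo W`. This is part 3b's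
`towerGapAtTwo_of_localKernelBounds` with its cover hypothesis `hN` DISCHARGED.
[cite: GreenbergLNM1716, §3 pp. 85–90 (Lemmas 3.3–3.5)] [cite: Washington1997, §13.1] -/
theorem towerGapAtTwo_of_localKernelBounds_sharp (htors : ¬ 2 ∣ W.torsionOrder) {j j' a d : ℕ}
    (hjj' : j ≤ j') (S : Finset (HeightOneSpectrum (𝓞 ℚ))) (C : HeightOneSpectrum (𝓞 ℚ) → ℕ)
    (hlow : ∀ κ : ZpExtension ℚ 2, κ.IsCyclotomic →
      2 ^ a ≤ Nat.card {z : W.selmerLayer κ j // 2 • z = 0})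
    (hup : ∀ κ : ZpExtension ℚ 2, κ.IsCyclotomic →
      Nat.card {z : W.selmerLayer κ j' // 2 • z = 0} ≤ 2 ^ d)
    (h0 : ∀ κ : ZpExtension ℚ 2, κ.IsCyclotomic →
      ∀ v ∉ S, W.localTowerKerPrimary κ (v.adicCompletion ℚ) j' = ⊥)
    (hC : ∀ κ : ZpExtension ℚ 2, κ.IsCyclotomic → ∀ v ∈ S,
      Finite {x : W.localTowerKerPrimary κ (v.adicCompletion ℚ) j' // 2 • x = 0} ∧
        Nat.card {x : W.localTowerKerPrimary κ (v.adicCompletion ℚ) j' // 2 • x = 0} ≤ C v)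
    (harith : 2 ^ d * ∏ v ∈ S, C v ^
        (if ((2 : ℕ) : 𝓞 ℚ) ∈ v.asIdeal then 1
          else 2 ^ min j' (padicValNat 2 (Rat.HeightOneSpectrum.natGenerator v ^ 2 - 1) - 3)) <
      2 ^ (2 ^ j' - 2 ^ j + a)) : TowerGapAtTwo W := by
  refine towerGapAtTwo_of_localKernelBounds W htors hjj' S C
    (fun v ↦ if ((2 : ℕ) : 𝓞 ℚ) ∈ v.asIdeal then 1
      else 2 ^ min j' (padicValNat 2 (Rat.HeightOneSpectrum.natGenerator v ^ 2 - 1) - 3))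
    hlow hup h0 hC (fun κ hκ v _ ↦ ?_) harith
  by_cases h2 : ((2 : ℕ) : 𝓞 ℚ) ∈ v.asIdeal
  · refine ⟨{1}, by rw [if_pos h2, Finset.card_singleton], ?_⟩
    exact TowerLayer.cover_singleton_at_p κ hκ v h2 j'
  · rw [if_neg h2]
    exact TowerLayer.exists_cover_card_le_odd_two hκ v h2 j'

/-- **The GAP certificate with every local error term from PRINT + certificates, SHARP covers.**
GEN 0's `towerGapAtTwo_of_layerSelmer_of_greenberg` (PRINT Greenberg L.3.3 both parts `h33g`/`h33`,
L.3.4 for `ℚ` `h34`; certificates `hlow`, `hup`, `β_v ≥ #B_v/(B_v)_div` at the odd `v ∈ S`) with the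
arithmetic `2^d · ∏_{v ∈ S} (2 ∈ v ? |Ẽ(𝔽₂)_2|² : β_v^{N_v}) < 2^{2^{j'} − 2^j + a}` at the SHARP
`N_v = 2^{min(j', v₂(ℓ_v² − 1) − 3)}`. [cite: GreenbergLNM1716, §3 Lemmas 3.3, 3.4, 3.5 (PDF pp. 86–90)]
[cite: Washington1997, §13.1] -/
theorem towerGapAtTwo_of_layerSelmer_of_greenberg_sharp
    (h33g : lemma33_localTowerKerPrimary_eq_bot_of_good.{0})
    (h33 : lemma33_natCard_localTowerKerPrimary_le.{0})
    (h34 : lemma34_natCard_localTowerKerPrimary_eq_rat)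
    (hgo : GoodOrd W 2) (htors : ¬ 2 ∣ W.torsionOrder) {j j' a d : ℕ} (hjj' : j ≤ j')
    (S : Finset (HeightOneSpectrum (𝓞 ℚ)))
    (hS : ∀ v ∉ S, ((2 : ℕ) : 𝓞 ℚ) ∉ v.asIdeal ∧ W.HasGoodReductionAt v)
    (β : HeightOneSpectrum (𝓞 ℚ) → ℕ)
    (hβ : ∀ κ : ZpExtension ℚ 2, κ.IsCyclotomic → ∀ v ∈ S, ((2 : ℕ) : 𝓞 ℚ) ∉ v.asIdeal →
      Nat.card (↥(W.localTopPrimary κ (v.adicCompletion ℚ)) ⧸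
        W.localTopPrimaryDiv κ (v.adicCompletion ℚ)) ≤ β v)
    (hlow : ∀ κ : ZpExtension ℚ 2, κ.IsCyclotomic →
      2 ^ a ≤ Nat.card {z : W.selmerLayer κ j // 2 • z = 0})
    (hup : ∀ κ : ZpExtension ℚ 2, κ.IsCyclotomic →
      Nat.card {z : W.selmerLayer κ j' // 2 • z = 0} ≤ 2 ^ d)
    (harith : 2 ^ d * ∏ v ∈ S,
        (if ((2 : ℕ) : 𝓞 ℚ) ∈ v.asIdeal then (2 ^ padicValNat 2 (W.reductionPointCount 2)) ^ 2
          else β v) ^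
        (if ((2 : ℕ) : 𝓞 ℚ) ∈ v.asIdeal then 1
          else 2 ^ min j' (padicValNat 2 (Rat.HeightOneSpectrum.natGenerator v ^ 2 - 1) - 3)) <
      2 ^ (2 ^ j' - 2 ^ j + a)) : TowerGapAtTwo W := by
  refine towerGapAtTwo_of_localKernelBounds_sharp W htors hjj' S
    (fun v ↦ if ((2 : ℕ) : 𝓞 ℚ) ∈ v.asIdeal then (2 ^ padicValNat 2 (W.reductionPointCount 2)) ^ 2
      else β v) hlow hup
    (fun κ hκ v hv ↦ h33g ℚ W 2 κ hκ v (hS v hv).1 (hS v hv).2 j') (fun κ hκ v hv ↦ ?_) harith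
  by_cases h2 : ((2 : ℕ) : 𝓞 ℚ) ∈ v.asIdeal
  · rw [if_pos h2]
    exact pTorsion_le_of_lemma34 h34 W 2 hgo κ hκ v h2 j'
  · rw [if_neg h2]
    obtain ⟨hfin, hle⟩ := pTorsion_le_of_lemma33 h33 W 2 κ hκ v h2 j'
    exact ⟨hfin, hle.trans (hβ κ hκ v hv h2)⟩

/-! ### The doors with the sharp exponent (rank / `λ_an` / `μ_an` road of parts 1–4) -/

/-- **Door (TOWER, sharp covers) for `BSD(E,2)` at analytic rank `0`** on a good-ordinary-at-`2` curve
with odd torsion order: PRINT {modularity, GZK, Kato 17.4 (1)(2)@2, Greenberg Thm. 4.1@2, Prop. 4.14@2,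
Lemma 3.3@2 (both parts), Lemma 3.4@2} + CERTIFICATES {`hper₀`, `μ_an = 0`, `λ_an = n`,
`2^n ≤ #Sel_{2^∞}(E/ℚ_{j₀})[2]`, `2^a ≤ #Sel_{2^∞}(E/ℚ_j)[2]`, `#Sel_{2^∞}(E/ℚ_{j'})[2] ≤ 2^d`, `β_v`,
sharp arithmetic} ⇒ `BSDp W 2`. [cite: GreenbergLNM1716, Thm. 4.1, Prop. 4.14, §3 Lemmas 3.3–3.5]
[cite: Kato2004Asterisque, Thm. 17.4 (1)(2) (p. 273)] [cite: Miller2011LMS, Def. 1.1] -/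
theorem bsdp_two_of_layerSelmer_of_greenberg_sharp (hmod : nonempty_modularParametrizationData)
    (hGZK : rank_eq_analyticRank_of_analyticRank_le_one)
    (h17 : ∀ [NeZero (W.conductorNorm ℤ)] (f : CuspForm (Gamma0 (W.conductorNorm ℤ)) 2),
      kato_divisibility_allPrimes W 2 (f := f))
    (hEC : TwoAdicEulerCharRankZero W 0) (h414 : prop414_noFiniteSubmodule_of_not_dvd_torsionOrder)
    (h33g : lemma33_localTowerKerPrimary_eq_bot_of_good.{0})
    (h33 : lemma33_natCard_localTowerKerPrimary_le.{0})
    (h34 : lemma34_natCard_localTowerKerPrimary_eq_rat)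
    (hper₀ : ∀ [NeZero (W.conductorNorm ℤ)] (f : CuspForm (Gamma0 (W.conductorNorm ℤ)) 2),
      IsNewformOf W f → ∀ ϖ : ℚ, (ϖ : ℝ) * W.realPeriodRat = plusPeriod f → 0 ≤ padicValRat 2 ϖ)
    (hgo : GoodOrd W 2) (hr : W.analyticRank = 0) (htors : ¬ 2 ∣ W.torsionOrder) {n j₀ j j' a d : ℕ}
    (hrank : ∀ κ : ZpExtension ℚ 2, κ.IsCyclotomic →
      2 ^ n ≤ Nat.card {z : W.selmerLayer κ j₀ // 2 • z = 0})
    (hjj' : j ≤ j') (S : Finset (HeightOneSpectrum (𝓞 ℚ)))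
    (hS : ∀ v ∉ S, ((2 : ℕ) : 𝓞 ℚ) ∉ v.asIdeal ∧ W.HasGoodReductionAt v)
    (β : HeightOneSpectrum (𝓞 ℚ) → ℕ)
    (hβ : ∀ κ : ZpExtension ℚ 2, κ.IsCyclotomic → ∀ v ∈ S, ((2 : ℕ) : 𝓞 ℚ) ∉ v.asIdeal →
      Nat.card (↥(W.localTopPrimary κ (v.adicCompletion ℚ)) ⧸
        W.localTopPrimaryDiv κ (v.adicCompletion ℚ)) ≤ β v)
    (hlow : ∀ κ : ZpExtension ℚ 2, κ.IsCyclotomic →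
      2 ^ a ≤ Nat.card {z : W.selmerLayer κ j // 2 • z = 0})
    (hup : ∀ κ : ZpExtension ℚ 2, κ.IsCyclotomic →
      Nat.card {z : W.selmerLayer κ j' // 2 • z = 0} ≤ 2 ^ d)
    (harith : 2 ^ d * ∏ v ∈ S,
        (if ((2 : ℕ) : 𝓞 ℚ) ∈ v.asIdeal then (2 ^ padicValNat 2 (W.reductionPointCount 2)) ^ 2
          else β v) ^
        (if ((2 : ℕ) : 𝓞 ℚ) ∈ v.asIdeal then 1
          else 2 ^ min j' (padicValNat 2 (Rat.HeightOneSpectrum.natGenerator v ^ 2 - 1) - 3)) <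
      2 ^ (2 ^ j' - 2 ^ j + a))
    (hlan : AnalyticLambdaEq W 2 n) (hμan : AnalyticMuLE W 2 0) : BSDp W 2 :=
  bsdp_two_of_towerGap_of_layerSelmer W hmod hGZK h17 hEC h414 hper₀ hgo hr htors
    (towerGapAtTwo_of_layerSelmer_of_greenberg_sharp W h33g h33 h34 hgo htors hjj' S hS β hβ hlow hup
      harith) hrank hlan hμan

/-- **Door (TOWER, sharp covers): `MazurMainConjecture W 2`** — any analytic rank, odd torsion order.
[cite: Kato2004Asterisque, Thm. 17.4 (1)(2) (p. 273)] [cite: GreenbergLNM1716, Prop. 4.14, §3 Lemmas 3.3–3.5] -/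
theorem mazurMainConjecture_two_of_layerSelmer_of_greenberg_sharp
    (h17 : ∀ [NeZero (W.conductorNorm ℤ)] (f : CuspForm (Gamma0 (W.conductorNorm ℤ)) 2),
      kato_divisibility_allPrimes W 2 (f := f))
    (h414 : prop414_noFiniteSubmodule_of_not_dvd_torsionOrder)
    (h33g : lemma33_localTowerKerPrimary_eq_bot_of_good.{0})
    (h33 : lemma33_natCard_localTowerKerPrimary_le.{0})
    (h34 : lemma34_natCard_localTowerKerPrimary_eq_rat)
    (hper₀ : ∀ [NeZero (W.conductorNorm ℤ)] (f : CuspForm (Gamma0 (W.conductorNorm ℤ)) 2),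
      IsNewformOf W f → ∀ ϖ : ℚ, (ϖ : ℝ) * W.realPeriodRat = plusPeriod f → 0 ≤ padicValRat 2 ϖ)
    (hgo : GoodOrd W 2) (htors : ¬ 2 ∣ W.torsionOrder) {n j₀ j j' a d : ℕ}
    (hrank : ∀ κ : ZpExtension ℚ 2, κ.IsCyclotomic →
      2 ^ n ≤ Nat.card {z : W.selmerLayer κ j₀ // 2 • z = 0})
    (hjj' : j ≤ j') (S : Finset (HeightOneSpectrum (𝓞 ℚ)))
    (hS : ∀ v ∉ S, ((2 : ℕ) : 𝓞 ℚ) ∉ v.asIdeal ∧ W.HasGoodReductionAt v)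
    (β : HeightOneSpectrum (𝓞 ℚ) → ℕ)
    (hβ : ∀ κ : ZpExtension ℚ 2, κ.IsCyclotomic → ∀ v ∈ S, ((2 : ℕ) : 𝓞 ℚ) ∉ v.asIdeal →
      Nat.card (↥(W.localTopPrimary κ (v.adicCompletion ℚ)) ⧸
        W.localTopPrimaryDiv κ (v.adicCompletion ℚ)) ≤ β v)
    (hlow : ∀ κ : ZpExtension ℚ 2, κ.IsCyclotomic →
      2 ^ a ≤ Nat.card {z : W.selmerLayer κ j // 2 • z = 0})
    (hup : ∀ κ : ZpExtension ℚ 2, κ.IsCyclotomic →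
      Nat.card {z : W.selmerLayer κ j' // 2 • z = 0} ≤ 2 ^ d)
    (harith : 2 ^ d * ∏ v ∈ S,
        (if ((2 : ℕ) : 𝓞 ℚ) ∈ v.asIdeal then (2 ^ padicValNat 2 (W.reductionPointCount 2)) ^ 2
          else β v) ^
        (if ((2 : ℕ) : 𝓞 ℚ) ∈ v.asIdeal then 1
          else 2 ^ min j' (padicValNat 2 (Rat.HeightOneSpectrum.natGenerator v ^ 2 - 1) - 3)) <
      2 ^ (2 ^ j' - 2 ^ j + a))
    (hlan : AnalyticLambdaEq W 2 n) (hμan : AnalyticMuLE W 2 0) : MazurMainConjecture W 2 :=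
  mazurMainConjecture_two_of_towerGap_of_layerSelmer W h17 h414 hper₀ hgo htors
    (towerGapAtTwo_of_layerSelmer_of_greenberg_sharp W h33g h33 h34 hgo htors hjj' S hS β hβ hlow hup
      harith) hrank hlan hμan

/-- **The Kato–Néron half (the item `OrdKatoHalfAtTwo` AT `W`), sharp covers.**
[cite: Kato2004Asterisque, Thm. 17.4 (1)(2) (p. 273)] [cite: GreenbergLNM1716, Prop. 4.14, §3 Lemmas 3.3–3.5] -/
theorem katoHalfAt_two_of_layerSelmer_of_greenberg_sharp
    (h17 : ∀ [NeZero (W.conductorNorm ℤ)] (f : CuspForm (Gamma0 (W.conductorNorm ℤ)) 2),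
      kato_divisibility_allPrimes W 2 (f := f))
    (h414 : prop414_noFiniteSubmodule_of_not_dvd_torsionOrder)
    (h33g : lemma33_localTowerKerPrimary_eq_bot_of_good.{0})
    (h33 : lemma33_natCard_localTowerKerPrimary_le.{0})
    (h34 : lemma34_natCard_localTowerKerPrimary_eq_rat)
    (hper₀ : ∀ [NeZero (W.conductorNorm ℤ)] (f : CuspForm (Gamma0 (W.conductorNorm ℤ)) 2),
      IsNewformOf W f → ∀ ϖ : ℚ, (ϖ : ℝ) * W.realPeriodRat = plusPeriod f → 0 ≤ padicValRat 2 ϖ)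
    (hgo : GoodOrd W 2) (htors : ¬ 2 ∣ W.torsionOrder) {n j₀ j j' a d : ℕ}
    (hrank : ∀ κ : ZpExtension ℚ 2, κ.IsCyclotomic →
      2 ^ n ≤ Nat.card {z : W.selmerLayer κ j₀ // 2 • z = 0})
    (hjj' : j ≤ j') (S : Finset (HeightOneSpectrum (𝓞 ℚ)))
    (hS : ∀ v ∉ S, ((2 : ℕ) : 𝓞 ℚ) ∉ v.asIdeal ∧ W.HasGoodReductionAt v)
    (β : HeightOneSpectrum (𝓞 ℚ) → ℕ)
    (hβ : ∀ κ : ZpExtension ℚ 2, κ.IsCyclotomic → ∀ v ∈ S, ((2 : ℕ) : 𝓞 ℚ) ∉ v.asIdeal →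
      Nat.card (↥(W.localTopPrimary κ (v.adicCompletion ℚ)) ⧸
        W.localTopPrimaryDiv κ (v.adicCompletion ℚ)) ≤ β v)
    (hlow : ∀ κ : ZpExtension ℚ 2, κ.IsCyclotomic →
      2 ^ a ≤ Nat.card {z : W.selmerLayer κ j // 2 • z = 0})
    (hup : ∀ κ : ZpExtension ℚ 2, κ.IsCyclotomic →
      Nat.card {z : W.selmerLayer κ j' // 2 • z = 0} ≤ 2 ^ d)
    (harith : 2 ^ d * ∏ v ∈ S,
        (if ((2 : ℕ) : 𝓞 ℚ) ∈ v.asIdeal then (2 ^ padicValNat 2 (W.reductionPointCount 2)) ^ 2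
          else β v) ^
        (if ((2 : ℕ) : 𝓞 ℚ) ∈ v.asIdeal then 1
          else 2 ^ min j' (padicValNat 2 (Rat.HeightOneSpectrum.natGenerator v ^ 2 - 1) - 3)) <
      2 ^ (2 ^ j' - 2 ^ j + a))
    (hlan : AnalyticLambdaEq W 2 n) (hμan : AnalyticMuLE W 2 0) :
    MainConjectureLowerDivisibilityAtTwoOrd W :=
  katoHalfAt_two_of_towerGap_of_layerSelmer W h17 h414 hper₀ hgo htors
    (towerGapAtTwo_of_layerSelmer_of_greenberg_sharp W h33g h33 h34 hgo htors hjj' S hS β hβ hlow hup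
      harith) hrank hlan hμan

/-! ### The doors in `Ш`-currency: no rank / `λ_an` / `μ_an` certificate, no Prop. 4.14 -/

/-- **Door (TOWER gap ∘ `Ш`-currency) for `BSD(E,2)` at analytic rank `0`** on a good-ordinary-at-`2`
curve with odd torsion order: PRINT {modularity `hmod`, GZK `hGZK`, Kato 17.4 (1)(2)@2 `h17`, Greenberg
Thm. 4.1@2 `hEC`, Lemma 3.3@2 `h33g`/`h33`, Lemma 3.4@2 `h34`} + CERTIFICATES {Néron integrality
`hper₀`, the gap data `hlow` (`2^a ≤ #Sel_{2^∞}(E/ℚ_j)[2]`), `hup` (`#Sel_{2^∞}(E/ℚ_{j'})[2] ≤ 2^d`),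
`β_v ≥ #B_v/(B_v)_div` at the odd bad `v`, the sharp arithmetic, and the descent inequality
`MissingLowerBoundAt W 2` (`ord₂ #Ш_an ≤ ord₂ #Ш`)} ⇒ `BSDp W 2`. Mechanism: the gap gives `X` torsion
with `μ = 0` (T10), hence the Kato half integrally; bsd-2adic-ord-3's
`EisensteinShaCurrency.bsdp_two_of_towerGap_of_missingLowerBoundAt` pinches with the descent
inequality. NO `hrank`, NO `λ_an`, NO `μ_an`, NO Prop. 4.14.
[cite: GreenbergLNM1716, Thm. 4.1 (p. 102), §3 Lemmas 3.3–3.5] [cite: Kato2004Asterisque, Thm. 17.4 (1)(2) (p. 273)]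
[cite: Miller2011LMS, Def. 1.1] [cite: Washington1997, §13.2] -/
theorem bsdp_two_of_layerSelmer_of_greenberg_sharp_of_missingLowerBoundAt
    (hmod : nonempty_modularParametrizationData) (hGZK : rank_eq_analyticRank_of_analyticRank_le_one)
    (h17 : ∀ [NeZero (W.conductorNorm ℤ)] (f : CuspForm (Gamma0 (W.conductorNorm ℤ)) 2),
      kato_divisibility_allPrimes W 2 (f := f))
    (hEC : TwoAdicEulerCharRankZero W 0)
    (h33g : lemma33_localTowerKerPrimary_eq_bot_of_good.{0})
    (h33 : lemma33_natCard_localTowerKerPrimary_le.{0})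
    (h34 : lemma34_natCard_localTowerKerPrimary_eq_rat)
    (hper₀ : ∀ [NeZero (W.conductorNorm ℤ)] (f : CuspForm (Gamma0 (W.conductorNorm ℤ)) 2),
      IsNewformOf W f → ∀ ϖ : ℚ, (ϖ : ℝ) * W.realPeriodRat = plusPeriod f → 0 ≤ padicValRat 2 ϖ)
    (hgo : GoodOrd W 2) (hr : W.analyticRank = 0) (htors : ¬ 2 ∣ W.torsionOrder) {j j' a d : ℕ}
    (hjj' : j ≤ j') (S : Finset (HeightOneSpectrum (𝓞 ℚ)))
    (hS : ∀ v ∉ S, ((2 : ℕ) : 𝓞 ℚ) ∉ v.asIdeal ∧ W.HasGoodReductionAt v)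
    (β : HeightOneSpectrum (𝓞 ℚ) → ℕ)
    (hβ : ∀ κ : ZpExtension ℚ 2, κ.IsCyclotomic → ∀ v ∈ S, ((2 : ℕ) : 𝓞 ℚ) ∉ v.asIdeal →
      Nat.card (↥(W.localTopPrimary κ (v.adicCompletion ℚ)) ⧸
        W.localTopPrimaryDiv κ (v.adicCompletion ℚ)) ≤ β v)
    (hlow : ∀ κ : ZpExtension ℚ 2, κ.IsCyclotomic →
      2 ^ a ≤ Nat.card {z : W.selmerLayer κ j // 2 • z = 0})
    (hup : ∀ κ : ZpExtension ℚ 2, κ.IsCyclotomic →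
      Nat.card {z : W.selmerLayer κ j' // 2 • z = 0} ≤ 2 ^ d)
    (harith : 2 ^ d * ∏ v ∈ S,
        (if ((2 : ℕ) : 𝓞 ℚ) ∈ v.asIdeal then (2 ^ padicValNat 2 (W.reductionPointCount 2)) ^ 2
          else β v) ^
        (if ((2 : ℕ) : 𝓞 ℚ) ∈ v.asIdeal then 1
          else 2 ^ min j' (padicValNat 2 (Rat.HeightOneSpectrum.natGenerator v ^ 2 - 1) - 3)) <
      2 ^ (2 ^ j' - 2 ^ j + a))
    (hsha : MissingLowerBoundAt W 2) : BSDp W 2 :=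
  EisensteinShaCurrency.bsdp_two_of_towerGap_of_missingLowerBoundAt W h17 hper₀ hEC hGZK hmod hgo hr
    (towerGapAtTwo_of_layerSelmer_of_greenberg_sharp W h33g h33 h34 hgo htors hjj' S hS β hβ hlow hup
      harith) hsha

/-- **Door (TOWER gap ∘ `Ш`-currency): the `2`-adic main conjecture `MazurMainConjecture W 2`** at a
rank-`0` good-ordinary `W` with odd torsion order, from the same PRINT + CERTIFICATES as
`bsdp_two_of_layerSelmer_of_greenberg_sharp_of_missingLowerBoundAt` (via ord-3's
`EisensteinShaCurrency.mazurMainConjecture_two_of_towerGap_of_missingLowerBoundAt`). In particular the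
item `OrdKatoHalfAtTwo` AT `W` follows (it is the `⊆` half). [cite: Kato2004Asterisque, Thm. 17.4 (1)(2) (p. 273)]
[cite: GreenbergLNM1716, Thm. 4.1 (p. 102), §3 Lemmas 3.3–3.5] [cite: Washington1997, §13.2] -/
theorem mazurMainConjecture_two_of_layerSelmer_of_greenberg_sharp_of_missingLowerBoundAt
    (hmod : nonempty_modularParametrizationData) (hGZK : rank_eq_analyticRank_of_analyticRank_le_one)
    (h17 : ∀ [NeZero (W.conductorNorm ℤ)] (f : CuspForm (Gamma0 (W.conductorNorm ℤ)) 2),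
      kato_divisibility_allPrimes W 2 (f := f))
    (hEC : TwoAdicEulerCharRankZero W 0)
    (h33g : lemma33_localTowerKerPrimary_eq_bot_of_good.{0})
    (h33 : lemma33_natCard_localTowerKerPrimary_le.{0})
    (h34 : lemma34_natCard_localTowerKerPrimary_eq_rat)
    (hper₀ : ∀ [NeZero (W.conductorNorm ℤ)] (f : CuspForm (Gamma0 (W.conductorNorm ℤ)) 2),
      IsNewformOf W f → ∀ ϖ : ℚ, (ϖ : ℝ) * W.realPeriodRat = plusPeriod f → 0 ≤ padicValRat 2 ϖ)
    (hgo : GoodOrd W 2) (hr : W.analyticRank = 0) (htors : ¬ 2 ∣ W.torsionOrder) {j j' a d : ℕ}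
    (hjj' : j ≤ j') (S : Finset (HeightOneSpectrum (𝓞 ℚ)))
    (hS : ∀ v ∉ S, ((2 : ℕ) : 𝓞 ℚ) ∉ v.asIdeal ∧ W.HasGoodReductionAt v)
    (β : HeightOneSpectrum (𝓞 ℚ) → ℕ)
    (hβ : ∀ κ : ZpExtension ℚ 2, κ.IsCyclotomic → ∀ v ∈ S, ((2 : ℕ) : 𝓞 ℚ) ∉ v.asIdeal →
      Nat.card (↥(W.localTopPrimary κ (v.adicCompletion ℚ)) ⧸
        W.localTopPrimaryDiv κ (v.adicCompletion ℚ)) ≤ β v)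
    (hlow : ∀ κ : ZpExtension ℚ 2, κ.IsCyclotomic →
      2 ^ a ≤ Nat.card {z : W.selmerLayer κ j // 2 • z = 0})
    (hup : ∀ κ : ZpExtension ℚ 2, κ.IsCyclotomic →
      Nat.card {z : W.selmerLayer κ j' // 2 • z = 0} ≤ 2 ^ d)
    (harith : 2 ^ d * ∏ v ∈ S,
        (if ((2 : ℕ) : 𝓞 ℚ) ∈ v.asIdeal then (2 ^ padicValNat 2 (W.reductionPointCount 2)) ^ 2
          else β v) ^
        (if ((2 : ℕ) : 𝓞 ℚ) ∈ v.asIdeal then 1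
          else 2 ^ min j' (padicValNat 2 (Rat.HeightOneSpectrum.natGenerator v ^ 2 - 1) - 3)) <
      2 ^ (2 ^ j' - 2 ^ j + a))
    (hsha : MissingLowerBoundAt W 2) : MazurMainConjecture W 2 :=
  EisensteinShaCurrency.mazurMainConjecture_two_of_towerGap_of_missingLowerBoundAt W h17 hper₀ hEC
    hGZK hmod hgo hr
    (towerGapAtTwo_of_layerSelmer_of_greenberg_sharp W h33g h33 h34 hgo htors hjj' S hS β hβ hlow hup
      harith) hsha

end Curve

end Summit.BirchSwinnertonDyer.BirchSwinnertonDyer.Theorems.KatoHalfPinch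

end
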